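import Literature.RepresentationTheory.GeneralLinear.PlethysmWordModel
import Literature.Computability.Complexity.PlethysmStabilityBIP
import HarnessLib

/-!
# The plethysm coefficient on the matrix space `MatIdx m` is the classical `a_λ(d, m)`

`SchurWeylPlethysm.lean` defines `plethysmCoeff k σ m χ` — the multiplicity of the highest weight
`χ` in G20's coordinate ring `k[Symᵐ (k^σ)]` (`coordRep σ k m`) — for every linearly ordered index
type `σ`, and GCT files use it on the lexicographically ordered matrix variables
`σ = MatIdx m = Fin m ×ₗ Fin m` at the weight `partitionWeightLex m λ = (λ^*)` transported along
`matIdxEquiv m` (BLMW 2011 (5.2.2); e.g. `orbitMultiplicity_le_plethysmCoeff`, IP 2017 Prop. 2.8,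
BIP 2019 §4).  `PlethysmWordModel.lean` identifies the `Fin N`-indexed version
`plethysmCoeffOfPartition k N m λ` with the word model, `= dim wreathHW k N 1 λ`, and shows that it
does not depend on `N ≥ ℓ(λ)` — i.e. it is the classical plethysm coefficient `a_λ(d, m)`, the
multiplicity of `S^λ V` in `Symᵈ Symᵐ V` (Fischer–Ikenmeyer 2020 §2 eq. (2)).  This file supplies the
missing bridge for the matrix space, so that numerical plethysm tables apply verbatim to the
`MatIdx`-typed statements of the tree:

* `plethysmCoeff_partitionWeightLex_eq_finrank_wreathHW` :
  `plethysmCoeff k (MatIdx m) m (partitionWeightLex m λ) = dim wreathHW k (m·m) 1 λ`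
  (`λ ⊢ d·m`, `ℓ(λ) ≤ m²`, `m ≠ 0`, characteristic zero) — the dictionary
  `h ↦ wordOfForm (revMatIdx m) m d h` of `PlethysmStability.lean` §5, read through the
  order-REVERSING enumeration `revMatIdx m : Fin (m·m) ≃ MatIdx m` of `PlethysmStabilityBIP.lean`, is
  a linear bijection (BIP 2019 (4.1); exactly as `highestWeightSpaceCoordRepEquiv` does for `Fin N`
  with `Fin.revPerm`);
* `plethysmCoeff_partitionWeightLex_eq_plethysmCoeffOfPartition` : `… = plethysmCoeffOfPartition k N m λ`
  for EVERY `N ≥ ℓ(λ)` — the matrix-space coefficient is the classical `a_λ(d, m)`.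

## References

* [BurgisserIkenmeyerPanovaJAMS2019] P. Bürgisser, C. Ikenmeyer, G. Panova, J. AMS 32 (2019), §4 (4.1)
  (`Sym^d Sym^n V = (⊗^{dn} V)^{S_d ≀ S_n}`).
* [FischerIkenmeyer2020] N. Fischer, C. Ikenmeyer, Comput. Complexity 29 (2020) 8, §2 eq. (2).
* [BurgisserEtAl2011] BLMW, SIAM J. Comput. 40 (2011), §4.4, (5.2.2) (a weight pins the degree; duals;
  the lexicographic matrix variables).

## Tree

`wordOfForm`, `formOfWord`, `wordOfForm_mem_highestWeightSpace`, `formOfWord_mem_highestWeightSpace`,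
`eq_of_wordOfForm_eq`, `wordOfForm_formOfWord`, `wordPerm_wordOfForm`, `wordOfForm_smul`
(`PlethysmStability`, general `σ`); `revMatIdx`, `strictAnti_revMatIdx`,
`neg_partitionWeightLex_revMatIdx` (`PlethysmStabilityBIP`); `partitionWeightLex`,
`size_partitionWeightLex` (`OccurrenceObstructionsBIP`); `wreathHW`, `finrank_wreathHW_eq_of_card_le`
(`WreathHighestWeight`); `plethysmCoeffOfPartition_eq_finrank_wreathHW` (`PlethysmWordModel`).
Theorems only; no definitions.
-/

noncomputable section

open scoped BigOperators

namespace Literature.RepresentationTheory.GeneralLinear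

open Literature.NumberTheory.DiophantineGeometry Literature.Computability.AlgebraicComplexity
open Literature.Computability.Complexity

section MatIdxDictionary

variable {k : Type*} [Field k] [CharZero k] {m d : ℕ}

omit [CharZero k] in
/-- `wordOfForm ρ` is additive for any enumeration `ρ` of the variables (the polarisation is
linear). [folklore] -/
theorem wordOfForm_add' {σ : Type*} [LinearOrder σ] [Fintype σ] {M n : ℕ} (ρ : Fin M ≃ σ)
    (h h' : MvPolynomial (DegIdx σ n) k) :
    wordOfForm (k := k) ρ n d (h + h') = wordOfForm ρ n d h + wordOfForm ρ n d h' := by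
  funext w
  rw [Pi.add_apply, wordOfForm_apply, wordOfForm_apply, wordOfForm_apply, ← polarizeLin_apply,
    map_add, Pi.add_apply, polarizeLin_apply, polarizeLin_apply]

/-- The weight of the word model attached to `partitionWeightLex m λ = λ^*` read through the
order-reversing `revMatIdx m` is `λ` itself. [folklore] -/
theorem neg_partitionWeightLex_comp_revMatIdx {D : ℕ} (lam : Nat.Partition D) :
    (fun i => -(partitionWeightLex m lam) (revMatIdx m i)) = Weight.ofPartition (m * m) lam :=
  funext fun i => neg_partitionWeightLex_revMatIdx m lam i

/-- A highest-weight vector of `k[Symᵐ (k^{m×m})]` of weight `λ^*`, `λ ⊢ d·m` with at most `m²`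
parts, is a form of degree `d` (`m ≠ 0`; a weight pins the degree, BLMW 2011 §4.4).
[cite: BurgisserEtAl2011, §4.4] -/
theorem isHomogeneous_of_mem_highestWeightSpace_partitionWeightLex (hm : m ≠ 0)
    {lam : Nat.Partition (d * m)} (hlam : lam.parts.card ≤ m * m)
    {h : MvPolynomial (DegIdx (MatIdx m) m) k}
    (hh : h ∈ highestWeightSpace (coordRep (MatIdx m) k m) (partitionWeightLex m lam)) :
    h.IsHomogeneous d :=
  isHomogeneous_of_mem_highestWeightSpace hm hh (size_partitionWeightLex lam hlam)

/-- The transported polarisation of a highest-weight vector of weight `λ^*` on the matrix space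
lies in `wreathHW k (m·m) 1 λ` (an `S_d ≀ S_m`-invariant highest-weight vector of weight `λ` of the
word model, BIP 2019 (4.1), read through `revMatIdx m`).
[cite: BurgisserIkenmeyerPanovaJAMS2019, §4 (4.1)] -/
theorem wordOfForm_revMatIdx_mem_wreathHW (hm : m ≠ 0) {lam : Nat.Partition (d * m)}
    (hlam : lam.parts.card ≤ m * m) {h : MvPolynomial (DegIdx (MatIdx m) m) k}
    (hh : h ∈ highestWeightSpace (coordRep (MatIdx m) k m) (partitionWeightLex m lam)) :
    wordOfForm (revMatIdx m) m d h ∈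
      wreathHW k (m * m) (1 : ↥(blockPerms d m) →* ℤˣ) (Weight.ofPartition (m * m) lam) := by
  refine ⟨?_, fun τ => ?_⟩
  · have := wordOfForm_mem_highestWeightSpace (M := m * m) (strictAnti_revMatIdx m)
      (isHomogeneous_of_mem_highestWeightSpace_partitionWeightLex hm hlam hh) hh
    rwa [neg_partitionWeightLex_comp_revMatIdx] at this
  · rw [MonoidHom.one_apply, Units.val_one, Int.cast_one, one_smul]
    exact wordPerm_wordOfForm _ h τ.2

/-- The form of an invariant highest-weight vector of the word model (alphabet `Fin (m·m)` read
into `MatIdx m` through `revMatIdx m`) is a highest-weight vector of `k[Symᵐ (k^{m×m})]` of weight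
`λ^* = partitionWeightLex m λ`. [cite: BurgisserIkenmeyerPanovaJAMS2019, §4 (4.1)] -/
theorem formOfWord_revMatIdx_mem_highestWeightSpace {D : ℕ} {lam : Nat.Partition D}
    {x : Word (m * m) (d * m) → k}
    (hx : x ∈ wreathHW k (m * m) (1 : ↥(blockPerms d m) →* ℤˣ) (Weight.ofPartition (m * m) lam)) :
    formOfWord (revMatIdx m) m d x ∈
      highestWeightSpace (coordRep (MatIdx m) k m) (partitionWeightLex m lam) := by
  refine formOfWord_mem_highestWeightSpace (M := m * m) (strictAnti_revMatIdx m)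
    (wordPerm_eq_of_mem_wreathHW_one hx) ?_
  rw [neg_partitionWeightLex_comp_revMatIdx]
  exact hx.1

variable (k m)

/-- **`plethysmCoeff` on the matrix space is the word-model dimension**:
`plethysmCoeff k (MatIdx m) m (partitionWeightLex m λ) = dim wreathHW k (m·m) 1 λ` for `λ ⊢ d·m` with
at most `m²` parts (`m ≠ 0`, characteristic zero): the dictionary `h ↦ wordOfForm (revMatIdx m) m d h`
is a linear bijection `HW_{λ^*}(k[Symᵐ (k^{m×m})]) → wreathHW k (m·m) 1 λ` — injective because the
polarisation is injective on forms of degree `d` (every highest-weight vector of weight `λ^*` is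
one), surjective by `formOfWord` — exactly as `highestWeightSpaceCoordRepEquiv` for `Fin N`.
FI 2020 §2 eq. (2) with BIP 2019 (4.1), for the lexicographically ordered matrix variables of
BLMW 2011 §5. [cite: FischerIkenmeyer2020, §2 (eq. (2))] -/
theorem plethysmCoeff_partitionWeightLex_eq_finrank_wreathHW (hm : m ≠ 0)
    (lam : Nat.Partition (d * m)) (hlam : lam.parts.card ≤ m * m) :
    plethysmCoeff k (MatIdx m) m (partitionWeightLex m lam) =
      Module.finrank k
        ↥(wreathHW k (m * m) (1 : ↥(blockPerms d m) →* ℤˣ) (Weight.ofPartition (m * m) lam)) := by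
  -- the dictionary as a linear map
  let Φ : ↥(highestWeightSpace (coordRep (MatIdx m) k m) (partitionWeightLex m lam)) →ₗ[k]
      ↥(wreathHW k (m * m) (1 : ↥(blockPerms d m) →* ℤˣ) (Weight.ofPartition (m * m) lam)) :=
    { toFun := fun h => ⟨wordOfForm (revMatIdx m) m d h.1, wordOfForm_revMatIdx_mem_wreathHW hm hlam h.2⟩
      map_add' := fun _ _ => Subtype.ext (wordOfForm_add' _ _ _)
      map_smul' := fun c _ => Subtype.ext (wordOfForm_smul _ c _) }
  have hΦ : Function.Bijective Φ := by
    refine ⟨fun h h' hhh' => ?_, fun x => ?_⟩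
    · exact Subtype.ext (eq_of_wordOfForm_eq (revMatIdx m)
        (isHomogeneous_of_mem_highestWeightSpace_partitionWeightLex hm hlam h.2)
        (isHomogeneous_of_mem_highestWeightSpace_partitionWeightLex hm hlam h'.2)
        (congrArg Subtype.val hhh'))
    · refine ⟨⟨formOfWord (revMatIdx m) m d (x : Word (m * m) (d * m) → k),
        formOfWord_revMatIdx_mem_highestWeightSpace x.2⟩, Subtype.ext ?_⟩
      exact wordOfForm_formOfWord _ (wordPerm_eq_of_mem_wreathHW_one x.2)
  exact (LinearEquiv.ofBijective Φ hΦ).finrank_eq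

/-- **The matrix-space plethysm coefficient is the classical `a_λ(d, m)`**: for `λ ⊢ d·m` with at
most `m²` parts and ANY alphabet size `N ≥ ℓ(λ)`,
`plethysmCoeff k (MatIdx m) m (partitionWeightLex m λ) = plethysmCoeffOfPartition k N m λ` — the
multiplicity of `S^λ V` in `Symᵈ Symᵐ V`, `dim V = N` (`m ≠ 0`, characteristic zero).  So plethysm
tables computed for partitions apply verbatim to the `MatIdx`-typed statements of the tree
(`orbitMultiplicity_le_plethysmCoeff`, the GCT multiplicity bounds).
[cite: FischerIkenmeyer2020, §2 (eq. (2))] -/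
theorem plethysmCoeff_partitionWeightLex_eq_plethysmCoeffOfPartition (hm : m ≠ 0)
    (lam : Nat.Partition (d * m)) (hlam : lam.parts.card ≤ m * m) {N : ℕ}
    (hN : lam.parts.card ≤ N) :
    plethysmCoeff k (MatIdx m) m (partitionWeightLex m lam) = plethysmCoeffOfPartition k N m lam := by
  rw [plethysmCoeff_partitionWeightLex_eq_finrank_wreathHW k m hm lam hlam,
    plethysmCoeffOfPartition_eq_finrank_wreathHW k N hm lam hN,
    finrank_wreathHW_eq_of_card_le k 1 lam hlam hN]

end MatIdxDictionary

end Literature.RepresentationTheory.GeneralLinear
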